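import Literature.NumberTheory.Transcendental.NesterenkoChowFormPrime
import Literature.NumberTheory.Transcendental.NesterenkoEliminationZerosK
import Mathlib.FieldTheory.IsAlgClosed.AlgebraicClosure
import HarnessLib

/-!
# Distinct homogeneous primes have distinct elimination ideals `𝔭̄(r)` (LNM 1752 Ch. 3 Prop. 4.4; Hodge–Pedoe II, X §7) — PROVED

`Literature/NumberTheory/Transcendental/NesterenkoChowFormDistinct.lean` — proofs only (no
definitions, nothing asserted). Sequel of `NesterenkoElimIdealPrime.lean` /
`NesterenkoChowFormPrime.lean`. Main result (`K = ℚ`, objects of `NesterenkoElimination.lean`):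

* `Nesterenko.eq_of_elimIdeal_eq` — for homogeneous primes `𝔭, 𝔭' ⊂ ℚ[x₀, …, x_m]` with
  `dim ℚ[x̲]/𝔭 = dim ℚ[x̲]/𝔭' = r`, `1 ≤ r ≤ m`: `𝔭̄(r) = 𝔭̄'(r) ⟹ 𝔭 = 𝔭'`. This is EXACTLY
  hypothesis (4) of the reduction `Nesterenko.NesterenkoPhilippon2001_ch3_prop_4_4_of`
  (`NesterenkoEliminationProofs.lean`) of the named fact `NesterenkoPhilippon2001_ch3_prop_4_4`
  ("different prime ideals have different associated forms", used there to show that the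
  exponents `k_j` in `F = F₁^{k₁} ⋯ F_s^{k_s}` are the exponents of the primary components);
  classically: "no two distinct varieties can have the same Cayley form" (Hodge–Pedoe II, Ch. X
  §7, p. 47), Philippon 1986 §1.
* `Nesterenko.le_of_elimIdeal_eq` — the one-sided version (`𝔭̄(r) = 𝔭̄'(r) ⟹ 𝔭' ⊆ 𝔭`, only
  `𝔭'` homogeneous).

## The proof (generic point + Hauptsatz + a transcendence-degree count)

Let `L = Frac(ℚ[x̲]/𝔭)`, `ξ = (x̄ₖ) ∈ L^{m+1}` the generic point of `V(𝔭)`, `xⱼ ∉ 𝔭`, and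
`Ω` an algebraic closure of `Frac(L[U])`. The "generic `r`-tuple of hyperplanes through `ξ`"
`u = Φⱼ(u_{ik}) ∈ Ω^{r(m+1)}` (`NesterenkoK.pivotMap`) annihilates exactly `𝔭̄(r)`
(`NesterenkoK.aeval_pivot_eq_zero_iff`, from `𝔭̄(r) = ker Φⱼ` of `NesterenkoElimIdealPrime`).
If `𝔭̄(r) = 𝔭̄'(r)`, every inertia form of `𝔭'` vanishes at `u`, so by the Hauptsatz over the
algebraically closed field `Ω` (`exists_mem_elimIdeal_aeval_ne_zero_of_isAlgClosed`,
`NesterenkoEliminationZerosK.lean`) the hyperplanes `u` have a common zero `β ∈ Ω^{m+1} ∖ 0` on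
`V(𝔭')`; normalise `β_{k₁} = 1`. The linear conditions read `∑_{k≠j} u_{ik} γₖ = 0` with
`γₖ = βₖ − ξₖ ξⱼ⁻¹ βⱼ` (`NesterenkoK.sum_pivot_mul_eq`).
* If `γ = 0` then `β = c ξ` (`c ≠ 0`), so every FORM of `𝔭'` vanishes at `ξ`, i.e. lies in `𝔭`
  (`NesterenkoK.aeval_xbar_eq_zero_iff`), whence `𝔭' ⊆ 𝔭` (`𝔭'` is generated by its forms).
* If some `γ_{k₀} ≠ 0` (`Nesterenko.false_of_off_generic_point`): the `r·m` elements `u_{ik}`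
  (`k ≠ j`, independent variables over `L`) together with a transcendence basis of `ℚ[ξ]`
  (`r` elements) are algebraically independent over `ℚ`, so `trdeg ℚ[ξ, β, u] ≥ rm + r`; but
  solving the linear conditions for the `u_{ik₀}` shows `ℚ[ξ, β, u]` algebraic over
  `ℚ[ξ, β, u_{ik} (k ≠ j, k₀)]`, of transcendence degree `≤ r + (r − 1) + r(m − 1)` — here
  `trdeg ℚ[β] ≤ r − 1` because `ℚ[β] ≅ ℚ[x̲]/Q` with `Q ⊋ 𝔭'` (`x_{k₁} − 1 ∈ Q` is not in the
  homogeneous ideal `𝔭'`) and `dim` drops along `𝔭' ⊊ Q`. Contradiction.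

Tools proved on the way: subadditivity `trdeg K[s ∪ t] ≤ trdeg K[s] + trdeg K[t]`
(`Literature.RingTheory.NoetherNormalization.trdeg_adjoin_union_le_add`), forms at proportional
points, `NesterenkoK.le_of_forall_isHomogeneous_mem`, `NesterenkoK.X_sub_one_notMem`.

## References

* [NesterenkoPhilippon2001] Yu. V. Nesterenko, P. Philippon (eds.), *Introduction to Algebraic
  Independence Theory*, LNM 1752, Springer 2001, Ch. 3 §4 Prop. 4.4 (p. 38) ("different prime
  ideals have different associated forms").
* [HodgePedoe1994] W. V. D. Hodge, D. Pedoe, *Methods of Algebraic Geometry* II (CUP 1952,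
  repr. 1994), Ch. X §6–§7 (the Cayley form determines the variety).
* [Philippon1986Criteres] P. Philippon, *Critères pour l'indépendance algébrique*, Publ. Math.
  IHÉS 64 (1986) 5–52, §1 (Prop. 1.3–1.5).
* B. L. van der Waerden, *Moderne Algebra* II, §80 (Trägheitsformen).
-/

noncomputable section

open MvPolynomial Cardinal

namespace Literature.RingTheory.NoetherNormalization

variable {K : Type*} [Field K] {F : Type*} [Field F] [Algebra K F]

/-- **Subadditivity of the transcendence degree**: `trdeg_K K[s ∪ t] ≤ trdeg_K K[s] + trdeg_K K[t]`.
[folklore] -/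
theorem trdeg_adjoin_union_le_add (s t : Set F) :
    Algebra.trdeg K (Algebra.adjoin K (s ∪ t)) ≤
      Algebra.trdeg K (Algebra.adjoin K s) + Algebra.trdeg K (Algebra.adjoin K t) := by
  -- a transcendence basis `B ⊆ t` of `K[t]`
  set A : Subalgebra K F := Algebra.adjoin K t with hA
  set t' : Set A := ((↑) : A → F) ⁻¹' t with ht'
  obtain ⟨e, he⟩ := exists_algEquiv_adjoin_preimage (K := K) A (t := t)
    (fun x hx => Algebra.subset_adjoin hx)
  haveI : Algebra.IsAlgebraic (Algebra.adjoin K t') A := by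
    refine ⟨fun a => ?_⟩
    have ha : IsAlgebraic (Algebra.adjoin K t) (a : F) := isAlgebraic_algebraMap a
    refine ha.of_ringHom_of_comp_eq (f := (e : Algebra.adjoin K t' →+* Algebra.adjoin K t))
      (g := (A.val : A →+* F)) e.surjective Subtype.val_injective ?_
    ext x
    simp only [RingHom.coe_comp, Function.comp_apply]
    exact he x
  obtain ⟨B, hBt, hB⟩ := exists_isTranscendenceBasis_subset (R := K) (A := A) t'
  have hcard : #B = Algebra.trdeg K A := hB.cardinalMk_eq_trdeg
  haveI halg : Algebra.IsAlgebraic (Algebra.adjoin K (Set.range ((↑) : B → A))) A := hB.isAlgebraic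
  set B' : Set F := ((↑) : A → F) '' B with hB'
  obtain ⟨e', he'⟩ := exists_algEquiv_adjoin_preimage (K := K) A (t := B')
    (by rintro _ ⟨b, hb, rfl⟩; exact b.2)
  have hpre : ((↑) : A → F) ⁻¹' B' = Set.range ((↑) : B → A) := by
    ext a
    simp only [hB', Set.mem_preimage, Set.mem_image, Set.mem_range]
    constructor
    · rintro ⟨b, hb, hba⟩
      exact ⟨⟨b, hb⟩, Subtype.val_injective hba⟩
    · rintro ⟨b, rfl⟩
      exact ⟨b, b.2, rfl⟩
  have htalg : ∀ x ∈ t, IsAlgebraic (Algebra.adjoin K B') x := by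
    intro x hxt
    have hxA : IsAlgebraic (Algebra.adjoin K (Set.range ((↑) : B → A)))
        (⟨x, Algebra.subset_adjoin hxt⟩ : A) := halg.isAlgebraic _
    rw [← hpre] at hxA
    have := hxA.ringHom_of_comp_eq (f := (e' : Algebra.adjoin K (((↑) : A → F) ⁻¹' B') →+*
        Algebra.adjoin K B')) (g := (A.val : A →+* F)) e'.injective ?_
    · exact this
    · ext z
      simp only [RingHom.coe_comp, Function.comp_apply]
      exact he' z
  -- `s ∪ t` is algebraic over `K[s ∪ B']`
  have hsalg : ∀ x ∈ s ∪ t, IsAlgebraic (Algebra.adjoin K (s ∪ B')) x := by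
    intro x hx
    rcases hx with hxs | hxt
    · exact isAlgebraic_algebraMap (⟨x, Algebra.subset_adjoin (Or.inl hxs)⟩ : Algebra.adjoin K (s ∪ B'))
    · exact (htalg x hxt).tower_top_of_subalgebra_le (Algebra.adjoin_mono Set.subset_union_right)
  calc Algebra.trdeg K (Algebra.adjoin K (s ∪ t))
      ≤ Algebra.trdeg K (Algebra.adjoin K (s ∪ B')) :=
        trdeg_adjoin_le_trdeg_adjoin_of_forall_isAlgebraic hsalg
    _ ≤ Algebra.trdeg K (Algebra.adjoin K s) + #B' := trdeg_adjoin_union_le _ _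
    _ = Algebra.trdeg K (Algebra.adjoin K s) + Algebra.trdeg K A := by
        rw [hB', Cardinal.mk_image_eq Subtype.val_injective, hcard]

end Literature.RingTheory.NoetherNormalization

namespace Literature.NumberTheory.Transcendental

namespace NesterenkoK

attribute [local instance] MvPolynomial.gradedAlgebra

variable {K : Type*} [Field K] {m : ℕ}

/-! ### Forms at proportional points; homogeneous ideals are determined by their forms -/

/-- `P(c β) = c^d P(β)` for a form `P` of degree `d` (any commutative `K`-algebra). [folklore] -/
theorem aeval_smul_of_isHomogeneous {S : Type*} [CommRing S] [Algebra K S]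
    {P : MvPolynomial (Fin (m + 1)) K} {d : ℕ} (hP : P.IsHomogeneous d) (c : S)
    (β : Fin (m + 1) → S) : aeval (c • β) P = c ^ d * aeval β P := by
  classical
  rw [aeval_def, aeval_def, eval₂_eq', eval₂_eq', Finset.mul_sum]
  refine Finset.sum_congr rfl fun s hs => ?_
  have hsd : ∑ i, s i = d := by
    have h := hP (mem_support_iff.1 hs)
    rw [Finsupp.weight_apply, Finsupp.sum_fintype _ _ (fun i => by simp)] at h
    simpa using h
  simp only [Pi.smul_apply, smul_eq_mul, mul_pow, Finset.prod_mul_distrib,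
    Finset.prod_pow_eq_pow_sum, hsd]
  ring

/-- A homogeneous ideal whose FORMS lie in `J` lies in `J`. [folklore] -/
theorem le_of_forall_isHomogeneous_mem {I J : Ideal (MvPolynomial (Fin (m + 1)) K)}
    (hI : I.IsHomogeneous (homogeneousSubmodule (Fin (m + 1)) K))
    (h : ∀ (n : ℕ) (P : MvPolynomial (Fin (m + 1)) K), P ∈ I → P.IsHomogeneous n → P ∈ J) :
    I ≤ J := by
  intro P hP
  rw [← sum_homogeneousComponent P]
  exact Ideal.sum_mem _ fun n _ =>
    h n _ (homogeneousComponent_mem_of_mem hI hP n) (homogeneousComponent_isHomogeneous n P)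

/-- A zero of a homogeneous ideal stays a zero after scaling. [folklore] -/
theorem aeval_smul_eq_zero_of_forall {S : Type*} [CommRing S] [Algebra K S]
    {I : Ideal (MvPolynomial (Fin (m + 1)) K)} (hI : I.IsHomogeneous (homogeneousSubmodule (Fin (m + 1)) K))
    {β : Fin (m + 1) → S} (hβ : ∀ P ∈ I, aeval β P = 0) (c : S) :
    ∀ P ∈ I, aeval (c • β) P = 0 := by
  intro P hP
  rw [← sum_homogeneousComponent P, map_sum]
  refine Finset.sum_eq_zero fun n _ => ?_
  rw [aeval_smul_of_isHomogeneous (homogeneousComponent_isHomogeneous n P),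
    hβ _ (homogeneousComponent_mem_of_mem hI hP n), mul_zero]

/-- `xₖ − 1` does not lie in a proper homogeneous ideal. [folklore] -/
theorem X_sub_one_notMem {I : Ideal (MvPolynomial (Fin (m + 1)) K)}
    (hI : I.IsHomogeneous (homogeneousSubmodule (Fin (m + 1)) K)) (hI' : I ≠ ⊤) (k : Fin (m + 1)) :
    (X k - 1 : MvPolynomial (Fin (m + 1)) K) ∉ I := by
  intro h
  apply hI'
  have h0 := homogeneousComponent_mem_of_mem hI h 0
  rw [homogeneousComponent_zero, coeff_sub, coeff_zero_X, coeff_zero_one, zero_sub] at h0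
  rw [Ideal.eq_top_iff_one]
  have : (1 : MvPolynomial (Fin (m + 1)) K) = -(C (-1 : K)) := by simp
  rw [this]
  exact I.neg_mem h0

/-! ### The generic point `ξ = (x̄ₖ)` and the generic hyperplanes through it, in an extension `Ω` -/

variable (𝔭 : Ideal (MvPolynomial (Fin (m + 1)) K)) [𝔭.IsPrime]

/-- **Generic point**: for an injective `K`-algebra map `φ : K(𝔭)[U] → Ω`, a polynomial vanishes at
`ξ = φ(x̄)` iff it lies in `𝔭`. [folklore] -/
theorem aeval_xbar_eq_zero_iff {r : ℕ} {Ω : Type*} [CommRing Ω] [Algebra K Ω]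
    (φ : MvPolynomial (Fin r × Fin (m + 1)) (FractionRing (MvPolynomial (Fin (m + 1)) K ⧸ 𝔭)) →ₐ[K] Ω)
    (hφ : Function.Injective φ) (P : MvPolynomial (Fin (m + 1)) K) :
    aeval (fun k => φ (C (xbar 𝔭 k))) P = 0 ↔ P ∈ 𝔭 := by
  have hcomp : (aeval (fun k => φ (C (xbar 𝔭 k))) : MvPolynomial (Fin (m + 1)) K →ₐ[K] Ω) =
      φ.comp ((IsScalarTower.toAlgHom K (FractionRing (MvPolynomial (Fin (m + 1)) K ⧸ 𝔭)) _).comp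
        (IsScalarTower.toAlgHom K (MvPolynomial (Fin (m + 1)) K) _)) := by
    refine MvPolynomial.algHom_ext fun k => ?_
    simp [xbar]
  rw [hcomp]
  simp only [AlgHom.coe_comp, Function.comp_apply, IsScalarTower.coe_toAlgHom']
  rw [MvPolynomial.algebraMap_eq, ← algebraMap_eq_zero_iff 𝔭 P]
  constructor
  · intro h
    have h1 : C (algebraMap (MvPolynomial (Fin (m + 1)) K)
        (FractionRing (MvPolynomial (Fin (m + 1)) K ⧸ 𝔭)) P) =
        (0 : MvPolynomial (Fin r × Fin (m + 1)) (FractionRing (MvPolynomial (Fin (m + 1)) K ⧸ 𝔭))) :=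
      hφ (h.trans (map_zero φ).symm)
    exact C_eq_zero.1 h1
  · intro h
    rw [h, C_0, map_zero]

/-- The generic hyperplanes through `ξ`: `u = φ(Φⱼ(u_{ik}))` annihilates exactly `Ī(r)`.
[folklore] -/
theorem aeval_pivot_eq_zero_iff {r : ℕ} {j : Fin (m + 1)}
    (hj : (X j : MvPolynomial (Fin (m + 1)) K) ∉ 𝔭) {Ω : Type*} [CommRing Ω] [Algebra K Ω]
    (φ : MvPolynomial (Fin r × Fin (m + 1)) (FractionRing (MvPolynomial (Fin (m + 1)) K ⧸ 𝔭)) →ₐ[K] Ω)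
    (hφ : Function.Injective φ) (G : MvPolynomial (Fin r × Fin (m + 1)) K) :
    aeval (fun p => φ (pivotMap 𝔭 r j (X (Sum.inl p)))) G = 0 ↔ G ∈ elimIdeal 𝔭 r := by
  have hcomp : (aeval (fun p => φ (pivotMap 𝔭 r j (X (Sum.inl p)))) :
      MvPolynomial (Fin r × Fin (m + 1)) K →ₐ[K] Ω) = φ.comp ((pivotMap 𝔭 r j).comp (rename Sum.inl)) := by
    refine MvPolynomial.algHom_ext fun p => ?_
    simp
  rw [hcomp, mem_elimIdeal_iff_pivotMap_eq_zero 𝔭 hj]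
  simp only [AlgHom.coe_comp, Function.comp_apply]
  constructor
  · intro h
    exact hφ (by rw [h, map_zero])
  · intro h
    rw [h, map_zero]

/-- The linear forms of the generic hyperplanes through `ξ`, evaluated at a point `β`:
`∑ₖ u_{ik} βₖ = ∑_{k ≠ j} u_{ik} (βₖ − ξₖ ξⱼ⁻¹ βⱼ)` (in a field `Ω`). [folklore] -/
theorem sum_pivot_mul_eq {r : ℕ} {j : Fin (m + 1)}
    (hj : (X j : MvPolynomial (Fin (m + 1)) K) ∉ 𝔭) {Ω : Type*} [Field Ω] [Algebra K Ω]
    (φ : MvPolynomial (Fin r × Fin (m + 1)) (FractionRing (MvPolynomial (Fin (m + 1)) K ⧸ 𝔭)) →ₐ[K] Ω)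
    (hφ : Function.Injective φ) (β : Fin (m + 1) → Ω) (i : Fin r) :
    ∑ k, φ (pivotMap 𝔭 r j (X (Sum.inl (i, k)))) * β k =
      ∑ k : {k : Fin (m + 1) // k ≠ j}, φ (X (i, (k : Fin (m + 1)))) *
        (β k - φ (C (xbar 𝔭 k)) * (φ (C (xbar 𝔭 j)))⁻¹ * β j) := by
  classical
  have hx : φ (C (xbar 𝔭 j)) ≠ 0 := by
    intro h0
    exact xbar_ne_zero 𝔭 hj (C_injective _ _ (hφ (by rw [h0, C_0, map_zero])))
  rw [← Finset.add_sum_erase _ _ (Finset.mem_univ j), pivotMap_X_inl_self]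
  rw [← Finset.sum_subtype (Finset.univ.erase j) (p := fun k : Fin (m + 1) => k ≠ j) (fun k => by simp)
    (fun k => φ (X (i, k)) * (β k - φ (C (xbar 𝔭 k)) * (φ (C (xbar 𝔭 j)))⁻¹ * β j))]
  have hrest : ∑ k ∈ Finset.univ.erase j, φ (pivotMap 𝔭 r j (X (Sum.inl (i, k)))) * β k =
      ∑ k ∈ Finset.univ.erase j, φ (X (i, k)) * β k := by
    refine Finset.sum_congr rfl fun k hk => ?_
    rw [pivotMap_X_inl_of_ne 𝔭 j (Finset.ne_of_mem_erase hk)]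
  rw [hrest]
  have hinv : φ (C (xbar 𝔭 j)⁻¹) = (φ (C (xbar 𝔭 j)))⁻¹ := by
    refine eq_inv_of_mul_eq_one_left ?_
    rw [← map_mul, ← map_mul, inv_mul_cancel₀ (xbar_ne_zero 𝔭 hj), C_1, map_one]
  simp only [map_mul, map_neg, map_sum, hinv, Finset.sum_mul, neg_mul, mul_sub,
    Finset.sum_sub_distrib]
  rw [neg_add_eq_sub]
  refine congrArg₂ _ rfl (Finset.sum_congr rfl fun k _ => ?_)
  ring

end NesterenkoK

/-! ### Distinct primes have distinct `𝔭̄(r)` (`K = ℚ`) -/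

namespace Nesterenko

variable {m : ℕ}

attribute [local instance] MvPolynomial.gradedAlgebra

/-- `card {k : Fin (m+1) // k ≠ j ∧ k ≠ k₀} = m − 1` for `k₀ ≠ j`. [folklore] -/
theorem card_subtype_ne_ne {j k₀ : Fin (m + 1)} (h : k₀ ≠ j) :
    Fintype.card {k : Fin (m + 1) // k ≠ j ∧ k ≠ k₀} = m - 1 := by
  classical
  rw [Fintype.card_subtype]
  have : (Finset.univ.filter (fun k : Fin (m + 1) => k ≠ j ∧ k ≠ k₀)) =
      (Finset.univ.erase j).erase k₀ := by
    ext k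
    simp only [Finset.mem_filter, Finset.mem_univ, true_and, Finset.mem_erase, ne_eq]
    tauto
  rw [this, Finset.card_erase_of_mem (Finset.mem_erase.2 ⟨h, Finset.mem_univ _⟩),
    Finset.card_erase_of_mem (Finset.mem_univ _), Finset.card_univ, Fintype.card_fin]
  omega

set_option synthInstance.maxHeartbeats 400000 in
set_option maxHeartbeats 1600000 in
/-- **The transcendence-degree count** behind "the Chow form determines the variety": with
`ξ = (x̄ₖ)` the generic point of `V(𝔭)` (`dim = r' = r − 1`) and `u_{ik}` (`k ≠ j`) independent
variables over `ℚ(ξ)`, no normalised zero `β` (`β_{k₁} = 1`) of a second homogeneous prime `𝔭'`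
of the same dimension can satisfy the `r` linear conditions `∑_{k≠j} u_{ik} γₖ = 0`,
`γₖ = βₖ − ξₖ ξⱼ⁻¹ βⱼ`, unless `γ = 0`: otherwise `ℚ[ξ, u]` (transcendence degree `r'+1 + (r'+1)m`)
would be algebraic over `ℚ[ξ, β, u_{ik} (k ≠ j, k₀)]`, of transcendence degree
`≤ (r'+1) + r' + (r'+1)(m−1)`. [folklore] -/
theorem false_of_off_generic_point {r' : ℕ} (𝔭 : Ideal (Rx m)) [h𝔭 : 𝔭.IsPrime]
    (hdim : ringKrullDim (Rx m ⧸ 𝔭) = (r' + 1 : ℕ)) {j : Fin (m + 1)} (hj : (X j : Rx m) ∉ 𝔭)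
    (𝔭' : Ideal (Rx m)) [h𝔭' : 𝔭'.IsPrime]
    (hhom' : 𝔭'.IsHomogeneous (homogeneousSubmodule (Fin (m + 1)) ℚ))
    (hdim' : ringKrullDim (Rx m ⧸ 𝔭') = (r' + 1 : ℕ))
    {Ω : Type} [Field Ω] [Algebra ℚ Ω]
    (φL : (MvPolynomial (Fin (r' + 1) × Fin (m + 1)) (FractionRing (Rx m ⧸ 𝔭))) →ₐ[ℚ] Ω) (hφ : Function.Injective φL)
    (β : Fin (m + 1) → Ω) {k₁ : Fin (m + 1)} (hβk₁ : β k₁ = 1) (hβI : ∀ P ∈ 𝔭', aeval β P = 0)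
    (hγ : ∀ i : Fin (r' + 1), ∑ k : {k : Fin (m + 1) // k ≠ j},
      φL (X (i, (k : Fin (m + 1)))) *
        (β k - φL (C (NesterenkoK.xbar 𝔭 k)) * (φL (C (NesterenkoK.xbar 𝔭 j)))⁻¹ * β j) = 0)
    {k₀ : {k : Fin (m + 1) // k ≠ j}}
    (hk₀ : β k₀ - φL (C (NesterenkoK.xbar 𝔭 k₀)) * (φL (C (NesterenkoK.xbar 𝔭 j)))⁻¹ * β j ≠ 0) :
    False := by
  classical
  have hm : 1 ≤ m := by
    rcases Nat.eq_zero_or_pos m with hm0 | hm0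
    · subst hm0
      exact absurd (Fin.ext (by have := k₀.1.isLt; have := j.isLt; omega)) k₀.2
    · exact hm0
  -- the `L`-algebra structure on `Ω` given by `φL ∘ C`, and the tower `ℚ ⊆ L ⊆ Ω`
  letI instLΩ : Algebra (FractionRing (Rx m ⧸ 𝔭)) Ω := ((φL : (MvPolynomial (Fin (r' + 1) × Fin (m + 1)) (FractionRing (Rx m ⧸ 𝔭))) →+* Ω).comp (algebraMap (FractionRing (Rx m ⧸ 𝔭)) (MvPolynomial (Fin (r' + 1) × Fin (m + 1)) (FractionRing (Rx m ⧸ 𝔭))))).toAlgebra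
  have hφC : ∀ y : (FractionRing (Rx m ⧸ 𝔭)), φL (C y) = algebraMap (FractionRing (Rx m ⧸ 𝔭)) Ω y := fun y => rfl
  haveI := IsScalarTower.of_algebraMap_eq (R := ℚ) (S := (FractionRing (Rx m ⧸ 𝔭))) (A := Ω) fun q => by
    show algebraMap ℚ Ω q = φL (algebraMap (FractionRing (Rx m ⧸ 𝔭)) (MvPolynomial (Fin (r' + 1) × Fin (m + 1)) (FractionRing (Rx m ⧸ 𝔭))) (algebraMap ℚ (FractionRing (Rx m ⧸ 𝔭)) q))
    rw [← IsScalarTower.algebraMap_apply ℚ (FractionRing (Rx m ⧸ 𝔭)) (MvPolynomial (Fin (r' + 1) × Fin (m + 1)) (FractionRing (Rx m ⧸ 𝔭))) q, AlgHom.commutes]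
  -- `φL` as an `L`-algebra map
  let φT : (MvPolynomial (Fin (r' + 1) × Fin (m + 1)) (FractionRing (Rx m ⧸ 𝔭))) →ₐ[(FractionRing (Rx m ⧸ 𝔭))] Ω := { (φL : (MvPolynomial (Fin (r' + 1) × Fin (m + 1)) (FractionRing (Rx m ⧸ 𝔭))) →+* Ω) with commutes' := fun _ => rfl }
  have hφT : Function.Injective φT := hφ
  -- (B1) everything in `Sξ ∪ Sβ ∪ SU` is algebraic over `T = ℚ[Sξ ∪ Sβ ∪ SU']`
  have hmemT : ∀ x, x ∈ ((Set.range (fun k : Fin (m + 1) => φL (C (NesterenkoK.xbar 𝔭 k)))) ∪ (Set.range β)) ∪ (Set.range (fun p : Fin (r' + 1) × {k : Fin (m + 1) // k ≠ j ∧ k ≠ (k₀ : Fin (m + 1))} => φL (X (p.1, (p.2 : Fin (m + 1)))))) → IsAlgebraic (Algebra.adjoin ℚ (((Set.range (fun k : Fin (m + 1) => φL (C (NesterenkoK.xbar 𝔭 k)))) ∪ (Set.range β)) ∪ (Set.range (fun p : Fin (r' + 1) × {k : Fin (m + 1) // k ≠ j ∧ k ≠ (k₀ : Fin (m + 1))}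 => φL (X (p.1, (p.2 : Fin (m + 1)))))))) x := fun x hx =>
    isAlgebraic_algebraMap (⟨x, Algebra.subset_adjoin hx⟩ : (Algebra.adjoin ℚ (((Set.range (fun k : Fin (m + 1) => φL (C (NesterenkoK.xbar 𝔭 k)))) ∪ (Set.range β)) ∪ (Set.range (fun p : Fin (r' + 1) × {k : Fin (m + 1) // k ≠ j ∧ k ≠ (k₀ : Fin (m + 1))} => φL (X (p.1, (p.2 : Fin (m + 1)))))))))
  have hξT : ∀ k : Fin (m + 1), IsAlgebraic (Algebra.adjoin ℚ (((Set.range (fun k : Fin (m + 1) => φL (C (NesterenkoK.xbar 𝔭 k)))) ∪ (Set.range β)) ∪ (Set.range (fun p : Fin (r' + 1) × {k : Fin (m + 1) // k ≠ j ∧ k ≠ (k₀ : Fin (m + 1))} => φL (X (p.1, (p.2 : Fin (m + 1)))))))) (φL (C (NesterenkoK.xbar 𝔭 k))) :=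
    fun k => hmemT _ (Or.inl (Or.inl ⟨k, rfl⟩))
  have hβT : ∀ k : Fin (m + 1), IsAlgebraic (Algebra.adjoin ℚ (((Set.range (fun k : Fin (m + 1) => φL (C (NesterenkoK.xbar 𝔭 k)))) ∪ (Set.range β)) ∪ (Set.range (fun p : Fin (r' + 1) × {k : Fin (m + 1) // k ≠ j ∧ k ≠ (k₀ : Fin (m + 1))} => φL (X (p.1, (p.2 : Fin (m + 1)))))))) (β k) := fun k => hmemT _ (Or.inl (Or.inr ⟨k, rfl⟩))
  have hγT : ∀ k : Fin (m + 1), IsAlgebraic (Algebra.adjoin ℚ (((Set.range (fun k : Fin (m + 1) => φL (C (NesterenkoK.xbar 𝔭 k)))) ∪ (Set.range β)) ∪ (Set.range (fun p : Fin (r' + 1) × {k : Fin (m + 1) // k ≠ j ∧ k ≠ (k₀ : Fin (m + 1))} => φL (X (p.1, (p.2 : Fin (m + 1))))))))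
      (β k - φL (C (NesterenkoK.xbar 𝔭 k)) * (φL (C (NesterenkoK.xbar 𝔭 j)))⁻¹ * β j) :=
    fun k => (hβT k).sub (((hξT k).mul (hξT j).inv).mul (hβT j))
  have halgU : ∀ x ∈ ((Set.range (fun k : Fin (m + 1) => φL (C (NesterenkoK.xbar 𝔭 k)))) ∪ (Set.range β)) ∪ (Set.range (fun p : Fin (r' + 1) × {k : Fin (m + 1) // k ≠ j} => φL (X (p.1, (p.2 : Fin (m + 1)))))), IsAlgebraic (Algebra.adjoin ℚ (((Set.range (fun k : Fin (m + 1) => φL (C (NesterenkoK.xbar 𝔭 k)))) ∪ (Set.range β)) ∪ (Set.range (fun p : Fin (r' + 1) × {k : Fin (m + 1) // k ≠ j ∧ k ≠ (k₀ : Fin (m + 1))} => φL (X (p.1, (p.2 : Fin (m + 1)))))))) x := by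
    intro x hx
    rcases hx with hx | ⟨⟨i, k⟩, rfl⟩
    · exact hmemT x (Or.inl hx)
    · dsimp only
      by_cases hkk : (k : Fin (m + 1)) = (k₀ : Fin (m + 1))
      · have hkk' : k = k₀ := Subtype.ext hkk
        rw [hkk']
        -- isolate `u_{ik₀}` in the linear relation
        have hrel := hγ i
        rw [← Finset.add_sum_erase _ _ (Finset.mem_univ k₀)] at hrel
        have hrest : IsAlgebraic (Algebra.adjoin ℚ (((Set.range (fun k : Fin (m + 1) => φL (C (NesterenkoK.xbar 𝔭 k)))) ∪ (Set.range β)) ∪ (Set.range (fun p : Fin (r' + 1) × {k : Fin (m + 1) // k ≠ j ∧ k ≠ (k₀ : Fin (m + 1))} => φL (X (p.1, (p.2 : Fin (m + 1)))))))) (∑ k' ∈ Finset.univ.erase k₀,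
            φL (X (i, (k' : Fin (m + 1)))) *
              (β k' - φL (C (NesterenkoK.xbar 𝔭 k')) * (φL (C (NesterenkoK.xbar 𝔭 j)))⁻¹ * β j)) := by
          refine Finset.sum_induction _ (fun y => IsAlgebraic (Algebra.adjoin ℚ (((Set.range (fun k : Fin (m + 1) => φL (C (NesterenkoK.xbar 𝔭 k)))) ∪ (Set.range β)) ∪ (Set.range (fun p : Fin (r' + 1) × {k : Fin (m + 1) // k ≠ j ∧ k ≠ (k₀ : Fin (m + 1))} => φL (X (p.1, (p.2 : Fin (m + 1)))))))) y) (fun a b ha hb => ha.add hb)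
            isAlgebraic_zero ?_
          intro k' hk'
          have hne : (k' : Fin (m + 1)) ≠ (k₀ : Fin (m + 1)) := fun e =>
            Finset.ne_of_mem_erase hk' (Subtype.ext e)
          exact (hmemT _ (Or.inr ⟨(i, ⟨k', k'.2, hne⟩), rfl⟩)).mul (hγT k')
        have heq : φL (X (i, (k₀ : Fin (m + 1)))) =
            -(∑ k' ∈ Finset.univ.erase k₀, φL (X (i, (k' : Fin (m + 1)))) *
              (β k' - φL (C (NesterenkoK.xbar 𝔭 k')) * (φL (C (NesterenkoK.xbar 𝔭 j)))⁻¹ * β j)) *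
            (β k₀ - φL (C (NesterenkoK.xbar 𝔭 k₀)) * (φL (C (NesterenkoK.xbar 𝔭 j)))⁻¹ * β j)⁻¹ := by
          rw [eq_mul_inv_iff_mul_eq₀ hk₀]
          exact eq_neg_of_add_eq_zero_left hrel
        rw [heq]
        exact hrest.neg.mul (hγT k₀).inv
      · exact hmemT _ (Or.inr ⟨(i, ⟨k, k.2, hkk⟩), rfl⟩)
  -- (B2) UPPER BOUND
  have hSU' : #(Set.range (fun p : Fin (r' + 1) × {k : Fin (m + 1) // k ≠ j ∧ k ≠ (k₀ : Fin (m + 1))} => φL (X (p.1, (p.2 : Fin (m + 1)))))) ≤ (((r' + 1) * (m - 1) : ℕ) : Cardinal) := by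
    have h2 := Cardinal.mk_range_le_lift
      (f := fun p : Fin (r' + 1) × {k : Fin (m + 1) // k ≠ j ∧ k ≠ (k₀ : Fin (m + 1))} =>
        φL (X (p.1, (p.2 : Fin (m + 1)))))
    rw [Cardinal.mk_fintype (Fin (r' + 1) × {k : Fin (m + 1) // k ≠ j ∧ k ≠ (k₀ : Fin (m + 1))}),
      Cardinal.lift_natCast, Fintype.card_prod, Fintype.card_fin, card_subtype_ne_ne k₀.2] at h2
    exact Cardinal.lift_le.1 (h2.trans_eq (Cardinal.lift_natCast _).symm)
  have hξtr : Algebra.trdeg ℚ (Algebra.adjoin ℚ (Set.range (fun k : Fin (m + 1) => φL (C (NesterenkoK.xbar 𝔭 k))))) = ((r' + 1 : ℕ) : Cardinal) := by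
    have hψ : Function.Injective (φL.comp (IsScalarTower.toAlgHom ℚ (FractionRing (Rx m ⧸ 𝔭)) (MvPolynomial (Fin (r' + 1) × Fin (m + 1)) (FractionRing (Rx m ⧸ 𝔭))))) :=
      hφ.comp (C_injective _ _)
    have himage := Literature.RingTheory.NoetherNormalization.lift_trdeg_adjoin_image_eq
      (φL.comp (IsScalarTower.toAlgHom ℚ (FractionRing (Rx m ⧸ 𝔭)) (MvPolynomial (Fin (r' + 1) × Fin (m + 1)) (FractionRing (Rx m ⧸ 𝔭))))) hψ (Set.range (NesterenkoK.xbar 𝔭))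
    rw [Cardinal.lift_id, Cardinal.lift_id, ← Set.range_comp,
      NesterenkoK.trdeg_adjoin_range_xbar, NesterenkoK.trdeg_quotient_eq_of_ringKrullDim_eq hdim]
      at himage
    exact himage
  have hβtr : Algebra.trdeg ℚ (Algebra.adjoin ℚ (Set.range β)) ≤ (r' : Cardinal) := by
    -- `ℚ[β] ≅ ℚ[x̲]/Q` with `𝔭' < Q`
    have hrange : Algebra.adjoin ℚ (Set.range β) = (aeval β : Rx m →ₐ[ℚ] Ω).range :=
      Algebra.adjoin_range_eq_range_aeval ℚ β
    have hle : 𝔭' ≤ RingHom.ker (aeval β : Rx m →ₐ[ℚ] Ω) := fun P hP => by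
      rw [RingHom.mem_ker]
      exact hβI P hP
    have hX1 : (X k₁ - 1 : Rx m) ∈ RingHom.ker (aeval β : Rx m →ₐ[ℚ] Ω) := by
      rw [RingHom.mem_ker, map_sub, aeval_X, hβk₁, map_one, sub_self]
    have hne : 𝔭' ≠ RingHom.ker (aeval β : Rx m →ₐ[ℚ] Ω) := fun e =>
      NesterenkoK.X_sub_one_notMem hhom' h𝔭'.ne_top k₁ (e ▸ hX1)
    haveI : (RingHom.ker (aeval β : Rx m →ₐ[ℚ] Ω)).IsPrime := RingHom.ker_isPrime _
    -- in the domain `ℚ[x̲]/𝔭'`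
    haveI : (Ideal.map (Ideal.Quotient.mk 𝔭') (RingHom.ker (aeval β : Rx m →ₐ[ℚ] Ω))).IsPrime :=
      Ideal.map_isPrime_of_surjective Ideal.Quotient.mk_surjective (by rwa [Ideal.mk_ker])
    have hne' : Ideal.map (Ideal.Quotient.mk 𝔭') (RingHom.ker (aeval β : Rx m →ₐ[ℚ] Ω)) ≠ ⊥ := by
      intro hbot
      rw [Ideal.map_eq_bot_iff_le_ker, Ideal.mk_ker] at hbot
      exact hne (le_antisymm hle hbot)
    have hstep := Literature.RingTheory.KrullDimension.ringKrullDim_quotient_add_one_le hne'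
    rw [hdim', ringKrullDim_eq_of_ringEquiv (DoubleQuot.quotQuotEquivQuotOfLE hle),
      ringKrullDim_eq_of_ringEquiv (Ideal.quotientKerEquivRange (aeval β : Rx m →ₐ[ℚ] Ω)).toRingEquiv]
      at hstep
    -- the range is an affine domain
    haveI : Algebra.FiniteType ℚ (aeval β : Rx m →ₐ[ℚ] Ω).range :=
      Algebra.FiniteType.of_surjective (aeval β : Rx m →ₐ[ℚ] Ω).rangeRestrict
        (AlgHom.rangeRestrict_surjective _)
    rw [Literature.RingTheory.KrullDimension.ringKrullDim_eq_trdeg ℚ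
      (aeval β : Rx m →ₐ[ℚ] Ω).range] at hstep
    have hnat : Cardinal.toNat (Algebra.trdeg ℚ (aeval β : Rx m →ₐ[ℚ] Ω).range) + 1 ≤ r' + 1 := by
      exact_mod_cast hstep
    rw [hrange, Literature.RingTheory.KrullDimension.trdeg_eq_toNat ℚ (aeval β : Rx m →ₐ[ℚ] Ω).range]
    exact_mod_cast (by omega : Cardinal.toNat (Algebra.trdeg ℚ (aeval β : Rx m →ₐ[ℚ] Ω).range) ≤ r')
  have hupper : Algebra.trdeg ℚ (Algebra.adjoin ℚ (((Set.range (fun k : Fin (m + 1) => φL (C (NesterenkoK.xbar 𝔭 k)))) ∪ (Set.range β)) ∪ (Set.range (fun p : Fin (r' + 1) × {k : Fin (m + 1) // k ≠ j} => φL (X (p.1, (p.2 : Fin (m + 1)))))))) ≤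
      (((r' + 1) + r' + (r' + 1) * (m - 1) : ℕ) : Cardinal) := by
    have s1 : Algebra.trdeg ℚ (Algebra.adjoin ℚ (((Set.range (fun k : Fin (m + 1) => φL (C (NesterenkoK.xbar 𝔭 k)))) ∪ (Set.range β)) ∪ (Set.range (fun p : Fin (r' + 1) × {k : Fin (m + 1) // k ≠ j} => φL (X (p.1, (p.2 : Fin (m + 1)))))))) ≤ Algebra.trdeg ℚ (Algebra.adjoin ℚ (((Set.range (fun k : Fin (m + 1) => φL (C (NesterenkoK.xbar 𝔭 k)))) ∪ (Set.range β)) ∪ (Set.range (fun p : Fin (r' + 1) × {k : Fin (m + 1) // k ≠ j ∧ k ≠ (k₀ : Fin (m + 1))} => φL (X (p.1, (p.2 : Fin (m + 1)))))))) :=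
      Literature.RingTheory.NoetherNormalization.trdeg_adjoin_le_trdeg_adjoin_of_forall_isAlgebraic halgU
    have s2 : Algebra.trdeg ℚ (Algebra.adjoin ℚ (((Set.range (fun k : Fin (m + 1) => φL (C (NesterenkoK.xbar 𝔭 k)))) ∪ (Set.range β)) ∪ (Set.range (fun p : Fin (r' + 1) × {k : Fin (m + 1) // k ≠ j ∧ k ≠ (k₀ : Fin (m + 1))} => φL (X (p.1, (p.2 : Fin (m + 1)))))))) ≤ Algebra.trdeg ℚ (Algebra.adjoin ℚ ((Set.range (fun k : Fin (m + 1) => φL (C (NesterenkoK.xbar 𝔭 k)))) ∪ (Set.range β))) + #(Set.range (fun p : Fin (r' + 1) × {k : Fin (m + 1) // k ≠ j ∧ k ≠ (k₀ : Fin (m + 1))} => φL (X (p.1, (p.2 : Fin (m + 1)))))) :=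
      Literature.RingTheory.NoetherNormalization.trdeg_adjoin_union_le _ _
    have s3 : Algebra.trdeg ℚ (Algebra.adjoin ℚ ((Set.range (fun k : Fin (m + 1) => φL (C (NesterenkoK.xbar 𝔭 k)))) ∪ (Set.range β))) ≤
        Algebra.trdeg ℚ (Algebra.adjoin ℚ (Set.range (fun k : Fin (m + 1) => φL (C (NesterenkoK.xbar 𝔭 k))))) + Algebra.trdeg ℚ (Algebra.adjoin ℚ (Set.range β)) :=
      Literature.RingTheory.NoetherNormalization.trdeg_adjoin_union_le_add _ _
    calc _ ≤ _ := s1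
      _ ≤ _ := s2
      _ ≤ (Algebra.trdeg ℚ (Algebra.adjoin ℚ (Set.range (fun k : Fin (m + 1) => φL (C (NesterenkoK.xbar 𝔭 k))))) + Algebra.trdeg ℚ (Algebra.adjoin ℚ (Set.range β))) + #(Set.range (fun p : Fin (r' + 1) × {k : Fin (m + 1) // k ≠ j ∧ k ≠ (k₀ : Fin (m + 1))} => φL (X (p.1, (p.2 : Fin (m + 1)))))) :=
          add_le_add s3 le_rfl
      _ ≤ (((r' + 1 : ℕ) : Cardinal) + (r' : Cardinal)) + (((r' + 1) * (m - 1) : ℕ) : Cardinal) :=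
          add_le_add (add_le_add hξtr.le hβtr) hSU'
      _ = (((r' + 1) + r' + (r' + 1) * (m - 1) : ℕ) : Cardinal) := by push_cast; ring
  -- (B3) LOWER BOUND: `u_{ik}` (`k ≠ j`) and a transcendence basis of `ℚ[x̄]` are independent
  obtain ⟨e₀, he₀⟩ := Literature.RingTheory.NoetherNormalization.exists_algEquiv_adjoin_preimage
    (K := ℚ) (Algebra.adjoin ℚ (Set.range (NesterenkoK.xbar 𝔭)) : Subalgebra ℚ (FractionRing (Rx m ⧸ 𝔭)))
    (t := Set.range (NesterenkoK.xbar 𝔭)) (fun x hx => Algebra.subset_adjoin hx)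
  haveI : Algebra.IsAlgebraic (Algebra.adjoin ℚ
      (((↑) : Algebra.adjoin ℚ (Set.range (NesterenkoK.xbar 𝔭)) → (FractionRing (Rx m ⧸ 𝔭))) ⁻¹' Set.range (NesterenkoK.xbar 𝔭)))
      (Algebra.adjoin ℚ (Set.range (NesterenkoK.xbar 𝔭))) := by
    refine ⟨fun a => ?_⟩
    have ha : IsAlgebraic (Algebra.adjoin ℚ (Set.range (NesterenkoK.xbar 𝔭))) (a : (FractionRing (Rx m ⧸ 𝔭))) :=
      isAlgebraic_algebraMap a
    refine ha.of_ringHom_of_comp_eq (f := (e₀ : _ →+* Algebra.adjoin ℚ (Set.range (NesterenkoK.xbar 𝔭))))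
      (g := ((Algebra.adjoin ℚ (Set.range (NesterenkoK.xbar 𝔭))).val : _ →+* (FractionRing (Rx m ⧸ 𝔭))))
      e₀.surjective Subtype.val_injective ?_
    ext x
    simp only [RingHom.coe_comp, Function.comp_apply]
    exact he₀ x
  obtain ⟨B, hBt, hB⟩ := exists_isTranscendenceBasis_subset (R := ℚ)
    (A := Algebra.adjoin ℚ (Set.range (NesterenkoK.xbar 𝔭)))
    (((↑) : Algebra.adjoin ℚ (Set.range (NesterenkoK.xbar 𝔭)) → (FractionRing (Rx m ⧸ 𝔭))) ⁻¹' Set.range (NesterenkoK.xbar 𝔭))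
  have hcardB : #B = ((r' + 1 : ℕ) : Cardinal) := by
    rw [hB.cardinalMk_eq_trdeg, NesterenkoK.trdeg_adjoin_range_xbar,
      NesterenkoK.trdeg_quotient_eq_of_ringKrullDim_eq hdim]
  have hxind : AlgebraicIndependent ℚ
      (fun b : B => ((b : Algebra.adjoin ℚ (Set.range (NesterenkoK.xbar 𝔭))) : (FractionRing (Rx m ⧸ 𝔭)))) :=
    hB.1.map' (f := (Algebra.adjoin ℚ (Set.range (NesterenkoK.xbar 𝔭))).val)
      (fun u v huv => Subtype.ext huv)
  have hemb : Function.Injective (fun p : Fin (r' + 1) × {k : Fin (m + 1) // k ≠ j} =>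
      (p.1, (p.2 : Fin (m + 1)))) := by
    rintro ⟨a, k⟩ ⟨a', k'⟩ e
    simp only [Prod.mk.injEq] at e
    rw [e.1, Subtype.ext e.2]
  have huind : AlgebraicIndependent (FractionRing (Rx m ⧸ 𝔭)) (fun p : Fin (r' + 1) × {k : Fin (m + 1) // k ≠ j} =>
      φL (X (p.1, (p.2 : Fin (m + 1))))) :=
    ((MvPolynomial.algebraicIndependent_X (Fin (r' + 1) × Fin (m + 1)) (FractionRing (Rx m ⧸ 𝔭))).comp _ hemb).map'
      (f := φT) hφT
  have hind := hxind.sumElim_comp huind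
  have hmemN : ∀ v, Sum.elim (fun p : Fin (r' + 1) × {k : Fin (m + 1) // k ≠ j} =>
      φL (X (p.1, (p.2 : Fin (m + 1)))))
      (algebraMap (FractionRing (Rx m ⧸ 𝔭)) Ω ∘ fun b : B =>
        ((b : Algebra.adjoin ℚ (Set.range (NesterenkoK.xbar 𝔭))) : (FractionRing (Rx m ⧸ 𝔭)))) v ∈
      Algebra.adjoin ℚ (((Set.range (fun k : Fin (m + 1) => φL (C (NesterenkoK.xbar 𝔭 k)))) ∪ (Set.range β)) ∪ (Set.range (fun p : Fin (r' + 1) × {k : Fin (m + 1) // k ≠ j} => φL (X (p.1, (p.2 : Fin (m + 1))))))) := by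
    rintro (p | b)
    · exact Algebra.subset_adjoin (Or.inr ⟨p, rfl⟩)
    · simp only [Sum.elim_inr, Function.comp_apply]
      obtain ⟨k, hk⟩ := hBt b.2
      rw [← hφC, ← hk]
      exact Algebra.subset_adjoin (Or.inl (Or.inl ⟨k, rfl⟩))
  have hind' := AlgebraicIndependent.of_comp (Algebra.adjoin ℚ (((Set.range (fun k : Fin (m + 1) => φL (C (NesterenkoK.xbar 𝔭 k)))) ∪ (Set.range β)) ∪ (Set.range (fun p : Fin (r' + 1) × {k : Fin (m + 1) // k ≠ j} => φL (X (p.1, (p.2 : Fin (m + 1)))))))).val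
    (x := fun v => (⟨_, hmemN v⟩ : Algebra.adjoin ℚ (((Set.range (fun k : Fin (m + 1) => φL (C (NesterenkoK.xbar 𝔭 k)))) ∪ (Set.range β)) ∪ (Set.range (fun p : Fin (r' + 1) × {k : Fin (m + 1) // k ≠ j} => φL (X (p.1, (p.2 : Fin (m + 1))))))))) hind
  have hlower := hind'.cardinalMk_le_trdeg
  rw [Cardinal.mk_sum, Cardinal.lift_id, Cardinal.lift_id,
    Cardinal.mk_fintype (Fin (r' + 1) × {k : Fin (m + 1) // k ≠ j}), Fintype.card_prod,
    Fintype.card_fin, hcardB] at hlower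
  have hcardι : Fintype.card {k : Fin (m + 1) // k ≠ j} = m := by simp
  rw [hcardι] at hlower
  -- (B4) contradiction
  have key := hlower.trans hupper
  have key' : (r' + 1) * m + (r' + 1) ≤ (r' + 1) + r' + (r' + 1) * (m - 1) := by exact_mod_cast key
  obtain ⟨m', rfl⟩ := Nat.exists_eq_add_of_le hm
  rw [Nat.add_sub_cancel_left] at key'
  nlinarith [key']

set_option synthInstance.maxHeartbeats 400000 in
set_option maxHeartbeats 1600000 in
/-- **The Chow form determines the prime** (one inclusion): for homogeneous primes `𝔭, 𝔭'` of
`ℚ[x₀, …, x_m]` (in fact only `𝔭'` needs to be homogeneous) with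
`dim ℚ[x̲]/𝔭 = dim ℚ[x̲]/𝔭' = r ≥ 1` and `𝔭̄(r) = 𝔭̄'(r)`, one has `𝔭' ⊆ 𝔭`. The generic `r`-tuple of hyperplanes through the generic point `ξ` of `V(𝔭)`
annihilates `𝔭̄(r) = 𝔭̄'(r)`, so (Hauptsatz, `exists_mem_elimIdeal_aeval_ne_zero_of_isAlgClosed`)
meets `V(𝔭')` in a point `β`; by `false_of_off_generic_point`, `β = ξ` projectively, whence the
forms of `𝔭'` vanish at `ξ`, i.e. lie in `𝔭` (Hodge–Pedoe II, Ch. X §7: "no two distinct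
varieties can have the same Cayley form"). [cite: NesterenkoPhilippon2001, Ch. 3 Prop. 4.4 (p. 38)] -/
theorem le_of_elimIdeal_eq {r : ℕ} (𝔭 𝔭' : Ideal (Rx m)) [h𝔭 : 𝔭.IsPrime] [h𝔭' : 𝔭'.IsPrime]
    (hr : 1 ≤ r) (hdim : ringKrullDim (Rx m ⧸ 𝔭) = r)
    (hhom' : 𝔭'.IsHomogeneous (homogeneousSubmodule (Fin (m + 1)) ℚ))
    (hdim' : ringKrullDim (Rx m ⧸ 𝔭') = r)
    (h : elimIdeal 𝔭 r = elimIdeal 𝔭' r) : 𝔭' ≤ 𝔭 := by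
  classical
  obtain ⟨r', rfl⟩ : ∃ r', r = r' + 1 := ⟨r - 1, by omega⟩
  have hdim0 : ringKrullDim (Rx m ⧸ 𝔭) ≠ 0 := by
    rw [hdim]; exact_mod_cast Nat.succ_ne_zero r'
  obtain ⟨j, hj⟩ := Literature.RingTheory.MvPolynomial.exists_X_notMem_of_ringKrullDim_ne_zero hdim0
  -- the injective `ℚ`-algebra map `φ : L[U] → Ω`, `Ω` an algebraic closure of `Frac(L[U])`
  set φ : (MvPolynomial (Fin (r' + 1) × Fin (m + 1)) (FractionRing (Rx m ⧸ 𝔭))) →ₐ[ℚ] (AlgebraicClosure (FractionRing (MvPolynomial (Fin (r' + 1) × Fin (m + 1)) (FractionRing (Rx m ⧸ 𝔭))))) := (algebraMap (MvPolynomial (Fin (r' + 1) × Fin (m + 1)) (FractionRing (Rx m ⧸ 𝔭))) (AlgebraicClosure (FractionRing (MvPolynomial (Fin (r' + 1) × Fin (m + 1)) (FractionRing (Rx m ⧸ 𝔭)))))).toRatAlgHom with hφdef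
  have hφ : Function.Injective φ := by
    change Function.Injective (algebraMap (MvPolynomial (Fin (r' + 1) × Fin (m + 1)) (FractionRing (Rx m ⧸ 𝔭))) (AlgebraicClosure (FractionRing (MvPolynomial (Fin (r' + 1) × Fin (m + 1)) (FractionRing (Rx m ⧸ 𝔭))))))
    rw [IsScalarTower.algebraMap_eq (MvPolynomial (Fin (r' + 1) × Fin (m + 1)) (FractionRing (Rx m ⧸ 𝔭))) (FractionRing (MvPolynomial (Fin (r' + 1) × Fin (m + 1)) (FractionRing (Rx m ⧸ 𝔭)))) (AlgebraicClosure (FractionRing (MvPolynomial (Fin (r' + 1) × Fin (m + 1)) (FractionRing (Rx m ⧸ 𝔭)))))]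
    exact (algebraMap (FractionRing (MvPolynomial (Fin (r' + 1) × Fin (m + 1)) (FractionRing (Rx m ⧸ 𝔭)))) (AlgebraicClosure (FractionRing (MvPolynomial (Fin (r' + 1) × Fin (m + 1)) (FractionRing (Rx m ⧸ 𝔭)))))).injective.comp (IsFractionRing.injective (MvPolynomial (Fin (r' + 1) × Fin (m + 1)) (FractionRing (Rx m ⧸ 𝔭))) _)
  have hx : φ (C (NesterenkoK.xbar 𝔭 j)) ≠ 0 := by
    intro h0
    exact NesterenkoK.xbar_ne_zero 𝔭 hj (C_injective _ _ (hφ (by rw [h0, C_0, map_zero])))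
  -- (1) the generic hyperplanes through `ξ` annihilate `𝔭̄'(r) = 𝔭̄(r)`
  have h1 : ∀ G ∈ elimIdeal 𝔭' (r' + 1),
      aeval (fun p : Fin (r' + 1) × Fin (m + 1) =>
        φ (NesterenkoK.pivotMap 𝔭 (r' + 1) j (X (Sum.inl p)))) G = 0 := by
    intro G hG
    rw [← h, elimIdeal_eq] at hG
    exact (NesterenkoK.aeval_pivot_eq_zero_iff 𝔭 hj φ hφ G).2 hG
  -- (2) the Hauptsatz: they have a common zero `β₀` on `V(𝔭')`
  have h2 : ∃ β : Fin (m + 1) → (AlgebraicClosure (FractionRing (MvPolynomial (Fin (r' + 1) × Fin (m + 1)) (FractionRing (Rx m ⧸ 𝔭))))), β ≠ 0 ∧ (∀ P ∈ 𝔭', aeval β P = 0) ∧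
      ∀ i : Fin (r' + 1), ∑ k, φ (NesterenkoK.pivotMap 𝔭 (r' + 1) j (X (Sum.inl (i, k)))) * β k = 0 := by
    by_contra hne
    push Not at hne
    obtain ⟨G, hG, hGu⟩ := exists_mem_elimIdeal_aeval_ne_zero_of_isAlgClosed hhom'
      (fun p : Fin (r' + 1) × Fin (m + 1) => φ (NesterenkoK.pivotMap 𝔭 (r' + 1) j (X (Sum.inl p))))
      (fun β hβ0 hβI => hne β hβ0 hβI)
    exact hGu (h1 G hG)
  obtain ⟨β₀, hβ₀, hβ₀I, hβ₀L⟩ := h2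
  -- normalise: `β k₁ = 1`
  obtain ⟨k₁, hk₁⟩ := Function.ne_iff.1 hβ₀
  set β : Fin (m + 1) → (AlgebraicClosure (FractionRing (MvPolynomial (Fin (r' + 1) × Fin (m + 1)) (FractionRing (Rx m ⧸ 𝔭))))) := (β₀ k₁)⁻¹ • β₀ with hβdef
  have hβk₁ : β k₁ = 1 := by
    simp only [hβdef, Pi.smul_apply, smul_eq_mul]
    exact inv_mul_cancel₀ hk₁
  have hβI : ∀ P ∈ 𝔭', aeval β P = 0 := NesterenkoK.aeval_smul_eq_zero_of_forall hhom' hβ₀I _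
  have hβL : ∀ i : Fin (r' + 1),
      ∑ k, φ (NesterenkoK.pivotMap 𝔭 (r' + 1) j (X (Sum.inl (i, k)))) * β k = 0 := by
    intro i
    have hi := hβ₀L i
    have e : ∑ k, φ (NesterenkoK.pivotMap 𝔭 (r' + 1) j (X (Sum.inl (i, k)))) * β k =
        (β₀ k₁)⁻¹ * ∑ k, φ (NesterenkoK.pivotMap 𝔭 (r' + 1) j (X (Sum.inl (i, k)))) * β₀ k := by
      rw [Finset.mul_sum]
      refine Finset.sum_congr rfl fun k _ => ?_
      simp only [hβdef, Pi.smul_apply, smul_eq_mul]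
      ring
    rw [e, hi, mul_zero]
  -- (3) the linear conditions in terms of `γ_k = β_k − ξ_k ξ_j⁻¹ β_j`
  have hγ : ∀ i : Fin (r' + 1), ∑ k : {k : Fin (m + 1) // k ≠ j},
      φ (X (i, (k : Fin (m + 1)))) *
        (β k - φ (C (NesterenkoK.xbar 𝔭 k)) * (φ (C (NesterenkoK.xbar 𝔭 j)))⁻¹ * β j) = 0 := by
    intro i
    rw [← NesterenkoK.sum_pivot_mul_eq 𝔭 hj φ hφ β i]
    exact hβL i
  by_cases hγ0 : ∀ k : {k : Fin (m + 1) // k ≠ j},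
      β k - φ (C (NesterenkoK.xbar 𝔭 k)) * (φ (C (NesterenkoK.xbar 𝔭 j)))⁻¹ * β j = 0
  · -- `β = c ξ`, so the forms of `𝔭'` vanish at `ξ`
    have hβj : β j ≠ 0 := by
      intro h0
      have hk : β k₁ = 0 := by
        by_cases hkj : k₁ = j
        · rw [hkj]; exact h0
        · have := hγ0 ⟨k₁, hkj⟩
          simp only [h0, mul_zero, sub_zero] at this
          exact this
      rw [hβk₁] at hk
      exact one_ne_zero hk
    have hc : β j * (φ (C (NesterenkoK.xbar 𝔭 j)))⁻¹ ≠ 0 := mul_ne_zero hβj (inv_ne_zero hx)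
    have hβc : β = (β j * (φ (C (NesterenkoK.xbar 𝔭 j)))⁻¹) • fun k => φ (C (NesterenkoK.xbar 𝔭 k)) := by
      funext k
      simp only [Pi.smul_apply, smul_eq_mul]
      by_cases hkj : k = j
      · rw [hkj, mul_assoc, inv_mul_cancel₀ hx, mul_one]
      · have := hγ0 ⟨k, hkj⟩
        simp only at this
        linear_combination this
    refine NesterenkoK.le_of_forall_isHomogeneous_mem hhom' fun n P hP hPn => ?_
    have h0 : aeval β P = 0 := hβI P hP
    rw [hβc, NesterenkoK.aeval_smul_of_isHomogeneous hPn] at h0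
    have h0' := (mul_eq_zero.1 h0).resolve_left (pow_ne_zero _ hc)
    exact (NesterenkoK.aeval_xbar_eq_zero_iff 𝔭 φ hφ P).1 h0'
  · -- impossible, by the transcendence-degree count
    exfalso
    push Not at hγ0
    obtain ⟨k₀, hk₀⟩ := hγ0
    exact false_of_off_generic_point 𝔭 hdim hj 𝔭' hhom' hdim' φ hφ β hβk₁ hβI hγ hk₀

/-- **Distinct homogeneous primes of the same dimension have distinct elimination ideals**
(`K = ℚ`): hypothesis (4) of `NesterenkoPhilippon2001_ch3_prop_4_4_of`
(`NesterenkoEliminationProofs.lean`), in its exact form (Hodge–Pedoe II, Ch. X §7).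
[cite: NesterenkoPhilippon2001, Ch. 3 Prop. 4.4 (p. 38)] -/
theorem eq_of_elimIdeal_eq (m r : ℕ) (𝔭 𝔭' : Ideal (Rx m)) (hr : 1 ≤ r) (_hrm : r ≤ m)
    (hhom : 𝔭.IsHomogeneous (homogeneousSubmodule (Fin (m + 1)) ℚ)) (h𝔭 : 𝔭.IsPrime)
    (hdim : ringKrullDim (Rx m ⧸ 𝔭) = r)
    (hhom' : 𝔭'.IsHomogeneous (homogeneousSubmodule (Fin (m + 1)) ℚ)) (h𝔭' : 𝔭'.IsPrime)
    (hdim' : ringKrullDim (Rx m ⧸ 𝔭') = r)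
    (h : elimIdeal 𝔭 r = elimIdeal 𝔭' r) : 𝔭 = 𝔭' :=
  le_antisymm (le_of_elimIdeal_eq 𝔭' 𝔭 hr hdim' hhom hdim h.symm)
    (le_of_elimIdeal_eq 𝔭 𝔭' hr hdim hhom' hdim' h)

end Nesterenko

end Literature.NumberTheory.Transcendental
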